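import Summits.QuantumFields.YangMills.Theorems.DirichletWindowLocalGaussianityExpMomentTangentLaw
import Summits.QuantumFields.YangMills.Theorems.DirichletWindowLocalGaussianityStubExpMomentBound
import Summits.QuantumFields.YangMills.Theorems.DirichletWindowLocalGaussianityStubSecondOrderLocalLaw
import Summits.QuantumFields.YangMills.Theorems.DirichletWindowLocalGaussianityStubKernelLower
import HarnessLib

/-!
# `DirichletWindow.LocalGaussianity` (item stmt-QuantumFields-12314), hence `FixedDistanceLower` (8938) and `PlaquetteVarianceUpper` (8939)

Route `DirichletWindow` of `QuantumFields/YangMills`, TARGET node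
`Summit.QuantumFields.YangMills.Theses.DirichletWindow.LocalGaussianity = FixedDistanceLower ∧ PlaquetteVarianceUpper`:
for every compact simple `G` and faithful unitary lattice representation `r`, uniformly over ALL infinite-volume
torus-limit states `μ` of 4-D Wilson lattice gauge theory at inverse coupling `β`, the axial plaquette–plaquette
covariance obeys `f_β(n e₀) ≥ A/(β² n⁸)` for `n ≥ n₀`, `β ≥ β_n`, and `f_β(0) ≤ B/β²` — leading-order local
weak-coupling Gaussianity of the RAW plaquette second moments (the fixed-lag / variance half of Chatterjee's
Problem 5.1, arXiv:1803.01950).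

Proof = line «exp-moment tangent law» (seat ym-idea-4 g4, lead prover ym-dw-p1): the landed composition
`LocalGaussianityExpMomentTangentLaw.localGaussianity_of` applied to the three landed stubs
`stub_expMomentBound` (chessboard exponential moments: FILS even tori / Osterwalder–Seiler odd tori / free-energy
constant term 8759 / thermodynamic limit), `stub_secondOrderLocalLaw` (`β² f_β(n e₀) → (D/2) c'_n²` uniformly over
limit states: tangent law `EquipartitionPinsProbe.stub_tangent` + rigidity ⇒ `curvatureGaussianField 4 D`, uniform
integrability from the exponential moments, Isserlis) and `stub_kernelLower` (`|c'_n| = c_n ≥ κ₀/n⁴`, Källén–Lehmann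
representation).  In particular `β² f_β(n e₀) → (D/2) c'_n²` with `c'_n ∼ −1/(π² n⁴)`: the SHARP leading order.

HONEST FRAMING: this closes the RECORD-level sub-DAG 12314 = 8938 ∧ 8939 (⇒ 8941 `XiDiverges` by the landed door
`xiDivergesOfFixedDistance_proof`) of the dormant summit routes `DirichletWindow` / `XiCompleteMonotonicity`; it is a
statement at FIXED lag as `β → ∞` — not volume-uniform clustering at fixed `β`, not a mass gap, not a continuum
limit; the Yang–Mills mass gap is NOT proved here.  References: S. Chatterjee, arXiv:1602.01222 §§11–14,
arXiv:1803.01950 Problem 5.1; Fröhlich–Israel–Lieb–Simon, CMP 62 (1978); Osterwalder–Seiler, Ann. Phys. 110 (1978);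
Garban–Sepúlveda, arXiv:2107.04021.
-/

set_option autoImplicit false

noncomputable section

namespace Summit.QuantumFields.YangMills.Theorems

open Summit.QuantumFields.YangMills.Cruxes.LocalGaussianity.ExpMomentTangentLaw
  (stub_expMomentBound stub_secondOrderLocalLaw stub_kernelLower)

/-- **The target `LocalGaussianity` of route `DirichletWindow` holds** (item stmt-QuantumFields-12314):
`FixedDistanceLower ∧ PlaquetteVarianceUpper`, by the composition `localGaussianity_of` of line «exp-moment tangent
law» applied to its three landed stubs. -/
theorem localGaussianity_proof : Summit.QuantumFields.YangMills.Theses.DirichletWindow.LocalGaussianity :=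
  LocalGaussianityExpMomentTangentLaw.localGaussianity_of stub_expMomentBound stub_secondOrderLocalLaw
    stub_kernelLower

/-- **`FixedDistanceLower` holds** (item stmt-QuantumFields-8938): `f_β(n e₀) ≥ A/(β² n⁸)` for `n ≥ n₀`, `β ≥ β_n`,
uniformly over torus-limit states — the first conjunct of `LocalGaussianity`. -/
theorem fixedDistanceLower_proof : Summit.QuantumFields.YangMills.Theses.DirichletWindow.FixedDistanceLower :=
  localGaussianity_proof.1

/-- **`PlaquetteVarianceUpper` holds** (item stmt-QuantumFields-8939): `f_β(0) = Var_μ(Re tr r(U_p)) ≤ B/β²` for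
`β ≥ β₁`, uniformly over torus-limit states — the second conjunct of `LocalGaussianity`. -/
theorem plaquetteVarianceUpper_proof : Summit.QuantumFields.YangMills.Theses.DirichletWindow.PlaquetteVarianceUpper :=
  localGaussianity_proof.2

end Summit.QuantumFields.YangMills.Theorems

end
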